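import Literature.AlgebraicGeometry.Motives.FaltingsECProofs
import HarnessLib

/-!
# Tate 1966, §1 Lemma 1 for elliptic curves: the cokernel of `Hom_K(E, E') ⊗ ℤ_ℓ → Hom(T_ℓ E, T_ℓ E')` is torsion-free

Sibling file of `Literature.AlgebraicGeometry.Motives.FaltingsEC` (D-0014: `Literature/` is
sorry-free; cited results are named facts `def X : Prop`). It serves the decomposition of the named
fact `Literature.AlgebraicGeometry.Motives.mem_span_range_tateModule_map_of_equivariant_of_finite` (Tate's theorem for elliptic
curves over a finite field, Tate, Invent. Math. 2 (1966), Main Theorem) recorded in that file.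

Tate (loc. cit., §1, proof of Lemma 1, p. 135): "the fact that (1) is injective with torsion-free
cokernel ... comes from the fact that if a `k`-homomorphism `f : A' → A''` vanishes on `A'_ℓ`, then
there is a `k`-homomorphism `g : A' → A''` such that `f = ℓ g`". For elliptic curves this input is
Silverman, *AEC*, Cor. III.4.11 for `[ℓ]` (the tree's named fact
`WeierstrassCurve.Isogeny.exists_eq_comp_nsmul_of_geomTorsion_le_ker`), and the torsion-freeness of
the cokernel is the following **saturation statement**, proved here from that named fact (hypothesis
`h411`), from `Hom_K(E, E')` being a group (`WeierstrassCurve.mem_homModule_iff_holds`, tree) and from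
the surjectivity of `T_ℓ E → E[ℓ]` (`Literature.AlgebraicGeometry.Motives.exists_proj_tateModule_eq`, tree):

* `Literature.AlgebraicGeometry.Motives.mem_span_tateModule_map_of_smul_mem`: for elliptic curves `E, E'` over any field `K`,
  a prime `ℓ ≠ char K` and a `ℤ_ℓ`-linear `f : T_ℓ E → T_ℓ E'`, if `ℓ • f` lies in the `ℤ_ℓ`-span
  `M` of the maps `T_ℓ φ` (`φ : E → E'` an isogeny over `K`), then so does `f`;
* `Literature.AlgebraicGeometry.Motives.mem_span_tateModule_map_of_pow_smul_mem`: the same with `ℓ ^ n • f`;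
* generic lemmas on Tate modules of abelian groups used here and in the sequel:
  `Literature.NumberTheory.EllipticCurves.TateModule.map_add`/`map_sub`/`map_neg`/`map_sum`/`map_zsmul` (`T_p` is additive in the
  morphism),
  `Literature.NumberTheory.EllipticCurves.TateModule.exists_pow_smul_eq_of_proj_eq_zero` (`ker (T_p A → A[p^n]) = p^n T_p A`),
  `Literature.NumberTheory.EllipticCurves.TateModule.proj_apply_eq_of_proj_eq`, `Literature.NumberTheory.EllipticCurves.TateModule.proj_intCast_smul`.

Consequently (Tate, Lemma 1: "the bijectivity of (1) is equivalent to that of (2)") the integral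
statement `mem_span_range_tateModule_map_of_equivariant_of_finite` is reduced to its rational form
"for every `Γ`-equivariant `f` some `ℓ ^ n • f` lies in `M`":
`Literature.AlgebraicGeometry.Motives.mem_span_range_tateModule_map_of_equivariant_of_finite_of_rational`.

## Proof of the saturation statement (Tate, loc. cit.; Silverman, *AEC*, proof of III.7.4)

Write `ℓ f = Σ α_φ T_ℓ(φ)` (finite sum), pick integers `a_φ ≡ α_φ (mod ℓ)`, `α_φ = a_φ + ℓ β_φ`,
and put `ψ = Σ a_φ φ ∈ Hom_K(E, E')`, `g = f - Σ β_φ T_ℓ(φ)`, so that `T_ℓ(ψ) = ℓ g`. Either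
`ψ = 0`, and then `g = 0` (`Hom(T_ℓ E, T_ℓ E')` is torsion-free); or `ψ` is an isogeny, which kills
`E[ℓ]` (every `P ∈ E[ℓ]` is the first component of some `x ∈ T_ℓ E`, and
`ψ P = (ℓ g x)_1 = 0`), hence `ψ = λ ∘ [ℓ]` for an isogeny `λ` over `K` (Cor. III.4.11), so
`ℓ g = T_ℓ(ψ) = ℓ T_ℓ(λ)` and `g = T_ℓ(λ)`. In both cases `f ∈ M`.

## References

* [Tate1966Endomorphisms] J. Tate, *Endomorphisms of abelian varieties over finite fields*,
  Invent. Math. 2 (1966), 134–144, §1, Lemma 1 (p. 135).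
* [SilvermanAEC2009] J. H. Silverman, *The Arithmetic of Elliptic Curves*, 2nd ed., GTM 106,
  Cor. III.4.11, Thm. III.7.4 (proof), III.7.7.
-/

noncomputable section

open scoped Classical

universe u v

namespace Literature.AlgebraicGeometry.Motives

/-! ## `T_p` is additive in the homomorphism -/

section TateModule
open Literature.NumberTheory.EllipticCurves (TateModule)
open Literature.NumberTheory.EllipticCurves.TateModule

variable {A : Type u} [AddCommGroup A] {B : Type v} [AddCommGroup B] {p : ℕ} [Fact p.Prime]

/-- `T_p (f + g) = T_p f + T_p g`. [folklore] -/
theorem _root_.Literature.NumberTheory.EllipticCurves.TateModule.map_add (f g : A →+ B) : map p (f + g) = map p f + map p g :=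
  LinearMap.ext fun _ ↦ TateModule.ext fun _ ↦ rfl

/-- `T_p 0 = 0`. [folklore] -/
theorem _root_.Literature.NumberTheory.EllipticCurves.TateModule.map_zero : map p (0 : A →+ B) = 0 :=
  LinearMap.ext fun _ ↦ TateModule.ext fun _ ↦ rfl

/-- `T_p (f - g) = T_p f - T_p g`. [folklore] -/
theorem _root_.Literature.NumberTheory.EllipticCurves.TateModule.map_sub (f g : A →+ B) : map p (f - g) = map p f - map p g :=
  LinearMap.ext fun _ ↦ TateModule.ext fun _ ↦ rfl

/-- `T_p (-f) = -T_p f`. [folklore] -/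
theorem _root_.Literature.NumberTheory.EllipticCurves.TateModule.map_neg (f : A →+ B) : map p (-f) = -map p f :=
  LinearMap.ext fun _ ↦ TateModule.ext fun _ ↦ rfl

/-- `T_p (Σ f_i) = Σ T_p f_i`. [folklore] -/
theorem _root_.Literature.NumberTheory.EllipticCurves.TateModule.map_sum {ι : Type*} (s : Finset ι) (f : ι → A →+ B) :
    map p (∑ i ∈ s, f i) = ∑ i ∈ s, map p (f i) :=
  _root_.map_sum (AddMonoidHom.mk' (fun f : A →+ B ↦ map p f) map_add) f s

/-- `T_p (n • f) = n • T_p f` for an integer `n`. [folklore] -/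
theorem _root_.Literature.NumberTheory.EllipticCurves.TateModule.map_zsmul (n : ℤ) (f : A →+ B) : map p (n • f) = n • map p f :=
  _root_.map_zsmul (AddMonoidHom.mk' (fun f : A →+ B ↦ map p f) map_add) n f

/-- An element of `T_p A` whose `n`-th component vanishes is divisible by `p ^ n`
(`ker (T_p A → A[p^n]) = p ^ n T_p A`; iterate `TateModule.div`), for any abelian group `A`.
Silverman, *AEC*, III.§7. [folklore] -/
theorem _root_.Literature.NumberTheory.EllipticCurves.TateModule.exists_pow_smul_eq_of_proj_eq_zero {n : ℕ} {a : TateModule A p} (h : proj p n a = 0) :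
    ∃ b : TateModule A p, (p : ℤ_[p]) ^ n • b = a := by
  induction n generalizing a with
  | zero => exact ⟨a, by rw [pow_zero, one_smul]⟩
  | succ n ih =>
    have h1 : proj p 1 a = 0 := by rw [← pow_smul_proj_self_add n 1 a, h, smul_zero]
    obtain ⟨b, hb⟩ := ih (a := div a h1) (by rw [proj_div, h])
    exact ⟨b, by rw [pow_succ', mul_smul, hb, p_smul_div]⟩

/-- For a `ℤ_p`-linear map `f : T_p A → T_p B` (any abelian groups), the `n`-th component of
`f y` depends only on the `n`-th component of `y`: `y ≡ y' (mod p^n)` forces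
`f y ≡ f y' (mod p^n)`. Silverman, *AEC*, III.§7. [folklore] -/
theorem _root_.Literature.NumberTheory.EllipticCurves.TateModule.proj_apply_eq_of_proj_eq (f : TateModule A p →ₗ[ℤ_[p]] TateModule B p) {n : ℕ}
    {y y' : TateModule A p} (h : proj p n y = proj p n y') : proj p n (f y) = proj p n (f y') := by
  obtain ⟨b, hb⟩ := exists_pow_smul_eq_of_proj_eq_zero (a := y - y')
    (by rw [_root_.map_sub, h, sub_self])
  rw [← sub_eq_zero, ← _root_.map_sub, ← _root_.map_sub, ← hb, map_smul, proj_pow_smul,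
    pow_smul_proj]

/-- Components of the action of an integer `k ∈ ℤ_[p]`: `((k : ℤ_[p]) • a)_n = k • a_n`. [folklore] -/
theorem _root_.Literature.NumberTheory.EllipticCurves.TateModule.proj_intCast_smul (k : ℤ) (a : TateModule A p) (n : ℕ) :
    proj p n ((k : ℤ_[p]) • a) = k • proj p n a := by
  rw [Int.cast_smul_eq_zsmul, _root_.map_zsmul]

/-- A `ℤ_p`-linear map into a Tate module killed by `p` is zero (`Hom(-, T_p B)` is
torsion-free). [folklore] -/
theorem _root_.Literature.NumberTheory.EllipticCurves.TateModule.linearMap_eq_zero_of_smul_eq_zero {M : Type*} [AddCommGroup M] [Module ℤ_[p] M]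
    {g : M →ₗ[ℤ_[p]] TateModule B p} (h : (p : ℤ_[p]) • g = 0) : g = 0 := by
  refine LinearMap.ext fun x ↦ eq_zero_of_pow_smul_eq_zero (k := 1) ?_
  rw [pow_one]
  exact LinearMap.congr_fun h x

/-- Cancelling `p` in `Hom(-, T_p B)`. [folklore] -/
theorem _root_.Literature.NumberTheory.EllipticCurves.TateModule.linearMap_smul_cancel {M : Type*} [AddCommGroup M] [Module ℤ_[p] M]
    {g g' : M →ₗ[ℤ_[p]] TateModule B p} (h : (p : ℤ_[p]) • g = (p : ℤ_[p]) • g') : g = g' := by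
  rw [← sub_eq_zero] at h ⊢
  rw [← smul_sub] at h
  exact linearMap_eq_zero_of_smul_eq_zero h

end TateModule

end Literature.AlgebraicGeometry.Motives

namespace Literature.AlgebraicGeometry.Motives

open WeierstrassCurve

variable {K : Type u} [Field K] {W W' : WeierstrassCurve K} (ℓ : ℕ) [Fact ℓ.Prime]

/-- The Tate-module map of `P ↦ λ (m • P)` is `m • T_ℓ(λ)`. [folklore] -/
theorem tateModule_map_eq_smul_of_eq_comp_nsmul {ψ lam : W.geomPoints →+ W'.geomPoints} {m : ℕ}
    (h : ∀ P, ψ P = lam (m • P)) :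
    Literature.NumberTheory.EllipticCurves.TateModule.map ℓ ψ = (m : ℤ_[ℓ]) • Literature.NumberTheory.EllipticCurves.TateModule.map ℓ lam := by
  refine LinearMap.ext fun x ↦ Literature.NumberTheory.EllipticCurves.TateModule.ext fun n ↦ ?_
  rw [Literature.NumberTheory.EllipticCurves.TateModule.proj_map, LinearMap.smul_apply, Literature.NumberTheory.EllipticCurves.TateModule.proj_natCast_smul,
    Literature.NumberTheory.EllipticCurves.TateModule.proj_map, h, map_nsmul]

/-- **Tate 1966, §1, Lemma 1 (torsion-free cokernel), elliptic curves: saturation at `ℓ`.**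
Let `E, E'` be elliptic curves over a field `K`, `ℓ` a prime with `ℓ ≠ 0` in `K`, and assume
Silverman, *AEC*, Cor. III.4.11 for `[m]` over `K` (the named fact
`Isogeny.exists_eq_comp_nsmul_of_geomTorsion_le_ker W W'`, hypothesis `h411`). If `f : T_ℓ E → T_ℓ E'`
is `ℤ_ℓ`-linear and `ℓ • f` lies in the `ℤ_ℓ`-span of the maps `T_ℓ φ`, `φ : E → E'` an isogeny over
`K`, then so does `f`. Tate, Invent. Math. 2 (1966), §1, proof of Lemma 1; Silverman, *AEC*,
proof of Thm. III.7.4. [cite: Tate1966Endomorphisms, §1 Lemma 1] -/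
theorem mem_span_tateModule_map_of_smul_mem [W.IsElliptic] [W'.IsElliptic] (hℓ : (ℓ : K) ≠ 0)
    (h411 : Isogeny.exists_eq_comp_nsmul_of_geomTorsion_le_ker W W')
    {f : W.tateModule ℓ →ₗ[ℤ_[ℓ]] W'.tateModule ℓ}
    (hf : (ℓ : ℤ_[ℓ]) • f ∈ Submodule.span ℤ_[ℓ]
      (Set.range fun φ : Isogeny W W' ↦ Literature.NumberTheory.EllipticCurves.TateModule.map ℓ φ.toAddMonoidHom)) :
    f ∈ Submodule.span ℤ_[ℓ]
      (Set.range fun φ : Isogeny W W' ↦ Literature.NumberTheory.EllipticCurves.TateModule.map ℓ φ.toAddMonoidHom) := by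
  set S := Submodule.span ℤ_[ℓ]
    (Set.range fun φ : Isogeny W W' ↦ Literature.NumberTheory.EllipticCurves.TateModule.map ℓ φ.toAddMonoidHom) with hS
  -- `ℓ f = Σ_{φ ∈ s} α φ • T_ℓ φ`
  obtain ⟨α, hα⟩ := (Finsupp.mem_span_range_iff_exists_finsupp).mp hf
  set s := α.support with hs
  -- integers `a φ ≡ α φ (mod ℓ)`, `α φ = a φ + ℓ β φ`
  set a : Isogeny W W' → ℕ := fun φ ↦ PadicInt.appr (α φ) 1 with ha
  have hβex : ∀ φ, ∃ β : ℤ_[ℓ], α φ - (a φ : ℤ_[ℓ]) = (ℓ : ℤ_[ℓ]) * β := fun φ ↦ by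
    have := PadicInt.appr_spec 1 (α φ)
    rw [pow_one] at this
    exact Ideal.mem_span_singleton.mp this
  choose β hβ using hβex
  have hαφ : ∀ φ, α φ = (a φ : ℤ_[ℓ]) + (ℓ : ℤ_[ℓ]) * β φ := fun φ ↦ by
    rw [← hβ φ, add_sub_cancel]
  -- `ψ = Σ a_φ φ ∈ Hom_K(E, E')` and `g = f - Σ β_φ T_ℓ φ`
  set ψ : W.geomPoints →+ W'.geomPoints := ∑ φ ∈ s, (a φ : ℤ) • φ.toAddMonoidHom with hψ
  set g : W.tateModule ℓ →ₗ[ℤ_[ℓ]] W'.tateModule ℓ :=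
    f - ∑ φ ∈ s, β φ • Literature.NumberTheory.EllipticCurves.TateModule.map ℓ φ.toAddMonoidHom with hg
  have hgS : ∑ φ ∈ s, β φ • Literature.NumberTheory.EllipticCurves.TateModule.map ℓ φ.toAddMonoidHom ∈ S :=
    Submodule.sum_mem _ fun φ _ ↦ Submodule.smul_mem _ _ (Submodule.subset_span ⟨φ, rfl⟩)
  -- `T_ℓ ψ = ℓ g`
  have hTψ : Literature.NumberTheory.EllipticCurves.TateModule.map ℓ ψ = (ℓ : ℤ_[ℓ]) • g := by
    rw [hψ, Literature.NumberTheory.EllipticCurves.TateModule.map_sum]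
    calc ∑ φ ∈ s, Literature.NumberTheory.EllipticCurves.TateModule.map ℓ ((a φ : ℤ) • φ.toAddMonoidHom)
        = ∑ φ ∈ s, (α φ • Literature.NumberTheory.EllipticCurves.TateModule.map ℓ φ.toAddMonoidHom
            - (ℓ : ℤ_[ℓ]) • (β φ • Literature.NumberTheory.EllipticCurves.TateModule.map ℓ φ.toAddMonoidHom)) :=
          Finset.sum_congr rfl fun φ _ ↦ by
            rw [Literature.NumberTheory.EllipticCurves.TateModule.map_zsmul, hαφ φ, add_smul, mul_smul, add_sub_cancel_right,
              ← Int.cast_smul_eq_zsmul ℤ_[ℓ], Int.cast_natCast]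
      _ = (ℓ : ℤ_[ℓ]) • f - (ℓ : ℤ_[ℓ]) • ∑ φ ∈ s, β φ • Literature.NumberTheory.EllipticCurves.TateModule.map ℓ φ.toAddMonoidHom := by
          rw [Finset.sum_sub_distrib, ← Finset.smul_sum, ← hα, Finsupp.sum]
      _ = (ℓ : ℤ_[ℓ]) • g := by rw [hg, smul_sub]
  -- it suffices to see `g ∈ S`
  suffices hgmem : g ∈ S by
    have : f = g + ∑ φ ∈ s, β φ • Literature.NumberTheory.EllipticCurves.TateModule.map ℓ φ.toAddMonoidHom := by
      rw [hg, sub_add_cancel]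
    rw [this]
    exact S.add_mem hgmem hgS
  -- `ψ ∈ Hom_K(E, E')` is `0` or an isogeny
  have hψmem : ψ ∈ homModule W W' :=
    Submodule.sum_mem _ fun φ _ ↦ Submodule.smul_mem _ _ φ.toAddMonoidHom_mem_homModule
  rcases (mem_homModule_iff_holds W W' ψ).mp hψmem with h0 | ⟨χ, hχ⟩
  · -- `ψ = 0`: then `ℓ g = 0`, `g = 0`
    have : (ℓ : ℤ_[ℓ]) • g = 0 := by rw [← hTψ, h0, Literature.NumberTheory.EllipticCurves.TateModule.map_zero]
    rw [Literature.NumberTheory.EllipticCurves.TateModule.linearMap_eq_zero_of_smul_eq_zero this]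
    exact S.zero_mem
  · -- `ψ = χ` an isogeny, killing `E[ℓ]`
    have hχtors : ∀ P ∈ geomTorsion W ℓ, χ P = 0 := by
      intro P hP
      have hP' : P ∈ geomTorsion W (ℓ ^ 1 : ℕ) := by rwa [pow_one]
      obtain ⟨x, rfl⟩ := exists_proj_tateModule_eq ℓ 1 hP'
      rw [← Isogeny.coe_toAddMonoidHom, hχ, ← Literature.NumberTheory.EllipticCurves.TateModule.proj_map, hTψ, LinearMap.smul_apply,
        ← pow_one (ℓ : ℤ_[ℓ]), Literature.NumberTheory.EllipticCurves.TateModule.proj_pow_smul, Literature.NumberTheory.EllipticCurves.TateModule.pow_smul_proj]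
    obtain ⟨lam, hlam⟩ := h411 hℓ χ hχtors
    have hχlam : Literature.NumberTheory.EllipticCurves.TateModule.map ℓ χ.toAddMonoidHom =
        (ℓ : ℤ_[ℓ]) • Literature.NumberTheory.EllipticCurves.TateModule.map ℓ lam.toAddMonoidHom :=
      tateModule_map_eq_smul_of_eq_comp_nsmul ℓ fun P ↦ hlam P
    have hglam : g = Literature.NumberTheory.EllipticCurves.TateModule.map ℓ lam.toAddMonoidHom :=
      Literature.NumberTheory.EllipticCurves.TateModule.linearMap_smul_cancel (by rw [← hTψ, ← hχ, hχlam])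
    rw [hglam]
    exact Submodule.subset_span ⟨lam, rfl⟩

/-- **Tate 1966, §1, Lemma 1, elliptic curves: the cokernel of
`Hom_K(E, E') ⊗ ℤ_ℓ → Hom(T_ℓ E, T_ℓ E')` has no `ℓ`-power torsion.** Under the hypotheses of
`mem_span_tateModule_map_of_smul_mem`, if `ℓ ^ n • f` lies in the `ℤ_ℓ`-span of the `T_ℓ φ` then so
does `f`. [cite: Tate1966Endomorphisms, §1 Lemma 1] -/
theorem mem_span_tateModule_map_of_pow_smul_mem [W.IsElliptic] [W'.IsElliptic] (hℓ : (ℓ : K) ≠ 0)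
    (h411 : Isogeny.exists_eq_comp_nsmul_of_geomTorsion_le_ker W W')
    {f : W.tateModule ℓ →ₗ[ℤ_[ℓ]] W'.tateModule ℓ} {n : ℕ}
    (hf : (ℓ : ℤ_[ℓ]) ^ n • f ∈ Submodule.span ℤ_[ℓ]
      (Set.range fun φ : Isogeny W W' ↦ Literature.NumberTheory.EllipticCurves.TateModule.map ℓ φ.toAddMonoidHom)) :
    f ∈ Submodule.span ℤ_[ℓ]
      (Set.range fun φ : Isogeny W W' ↦ Literature.NumberTheory.EllipticCurves.TateModule.map ℓ φ.toAddMonoidHom) := by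
  induction n generalizing f with
  | zero => rwa [pow_zero, one_smul] at hf
  | succ n ih =>
    refine mem_span_tateModule_map_of_smul_mem ℓ hℓ h411 (ih ?_)
    rwa [smul_smul, ← pow_succ]

variable (W W') in
/-- **Tate 1966, Lemma 1: the integral statement from the rational one.** For elliptic curves over
a finite field `k` and a prime `ℓ ≠ char k`, Tate's theorem
`mem_span_range_tateModule_map_of_equivariant_of_finite W W' ℓ` (bijectivity of the integral map (1))
follows from Cor. III.4.11 over `k` (`h411`) together with the *rational* surjectivity: every
`Γ_k`-equivariant `ℤ_ℓ`-linear `f : T_ℓ E → T_ℓ E'` has a multiple `ℓ ^ n • f` in the `ℤ_ℓ`-span of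
the `T_ℓ φ` (bijectivity of Tate's map (2), `ℚ_ℓ ⊗ Hom_k(E, E') → Hom_G(V_ℓ E, V_ℓ E')`).
Tate, Invent. Math. 2 (1966), §1, Lemma 1. [cite: Tate1966Endomorphisms, §1 Lemma 1] -/
theorem mem_span_range_tateModule_map_of_equivariant_of_finite_of_rational
    (h411 : Isogeny.exists_eq_comp_nsmul_of_geomTorsion_le_ker W W')
    (hrat : ∀ [Finite K] [W.IsElliptic] [W'.IsElliptic], (ℓ : K) ≠ 0 →
      ∀ f : W.tateModule ℓ →ₗ[ℤ_[ℓ]] W'.tateModule ℓ,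
        (∀ (σ : Field.absoluteGaloisGroup K) (x : W.tateModule ℓ), f (σ • x) = σ • f x) →
        ∃ n : ℕ, (ℓ : ℤ_[ℓ]) ^ n • f ∈ Submodule.span ℤ_[ℓ]
          (Set.range fun φ : Isogeny W W' ↦ Literature.NumberTheory.EllipticCurves.TateModule.map ℓ φ.toAddMonoidHom)) :
    mem_span_range_tateModule_map_of_equivariant_of_finite W W' ℓ := by
  intro _ _ _ hℓ f hf
  obtain ⟨n, hn⟩ := hrat hℓ f hf
  exact mem_span_tateModule_map_of_pow_smul_mem ℓ hℓ h411 hn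

end Literature.AlgebraicGeometry.Motives
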